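import Mathlib
import HarnessLib
import Literature.MathematicalPhysics.StatisticalMechanics.TorusFRDKernelComparison
import Literature.MathematicalPhysics.StatisticalMechanics.TorusFRDFinalMultipliers
import Literature.MathematicalPhysics.StatisticalMechanics.TorusFRDModeDataHolds
import Literature.MathematicalPhysics.StatisticalMechanics.TorusMultiplierKernels

/-!
# The step kernels `𝒞_{1+q,k}` of the torus decomposition vs the weight kernels `𝒞_{1,k}`:
# `Re 𝒞̂_{1+q,k}(κ) ≤ (1+ρ) · Re 𝒞̂_{1,k}(κ)` for EVERY mode, `‖q‖` small ([ABKM19] (7.75))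

The form in which the `q`-layer consumes [ABKM19] (7.75): writing the tuning parameter as
`q = T·B` with `B` a unit symmetric direction and `0 ≤ T ≤ ½`, the segment `1 + tB`, `t ∈ [0,T]`,
stays in the elliptic class `𝓛(½, 2)` (`isElliptic_one_add_smul`), so
`TorusFRDKernelComparison.re_fourierCoeff_le_one_add_mul_of_torusFRD` applies to every nonzero mode
(`exists_inShell`), while at the zero mode both sides vanish (zero sums, clause (o)).  Result, for a
package `𝒞f` with clauses (o), (iv), (v) of `TorusFRD d` at `ω₀ = ½`, `Ω₀ = 2`:

* `isSymm_one_add_smul`, `isElliptic_one_add_smul`;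
* **`re_fourierCoeff_one_add_smul_le`** — `∀ κ, Re 𝒞̂_{1+T•B,k}(κ) ≤ (1+ρ) · Re 𝒞̂_{1,k}(κ)` for
  `shellRatioConst c (Cℓ 1) L d ñ · T ≤ log (1+ρ)`, `ρ ≥ 0`;
* `re_fourierCoeff_nonneg_of_torusFRD` — `0 ≤ Re 𝒞̂_{A,k}(κ)` for every elliptic `A` and every mode.

These are exactly the hypotheses `hq_le`, `hq_nonneg` of
`AbkmWeightBounds.stepKernelBounds_of_multipliers_le` (with `cExt_of_mem`).  Everything is proved; no
named fact.

## References
* S. Adams, S. Buchholz, R. Kotecký, S. Müller, arXiv:1910.13564, Lemma 7.7 (7.75)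
  [AdamsBuchholzKoteckyMuller2019].
* S. Buchholz, J. Funct. Anal. 275 (2018), Thm 2.4 [Buchholz2016].
-/

noncomputable section

namespace Literature.MathematicalPhysics.StatisticalMechanics.GradientRG

open Real Set Finset
open Literature.MathematicalPhysics.StatisticalMechanics.GradientFRD
  (fourierCoeff IsElliptic IsUnitSymm InShell exists_inShell re_fourierCoeff_zero_of_sum_eq_zero)

variable {d M : ℕ} [NeZero M]

/-- `1 + t•B` is symmetric for symmetric `B`. [cite: Buchholz2016, Thm 2.4] -/
theorem isSymm_one_add_smul {B : Matrix (Fin d) (Fin d) ℝ} (hB : B.IsSymm) (t : ℝ) :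
    ((1 : Matrix (Fin d) (Fin d) ℝ) + t • B).IsSymm :=
  Matrix.IsSymm.add Matrix.isSymm_one (hB.smul t)

/-- **The segment `1 + tB`, `0 ≤ t ≤ ½`, `B` unit symmetric, lies in the elliptic class `𝓛(½, 2)`**:
`(1 − t)|z|² ≤ z·(1+tB)z ≤ (1+t)|z|²`. [cite: AdamsBuchholzKoteckyMuller2019, Lemma 7.7 (the condition κ ≤ ω₀/2)] -/
theorem isElliptic_one_add_smul {B : Matrix (Fin d) (Fin d) ℝ} (hB : IsUnitSymm B) {t : ℝ}
    (ht0 : 0 ≤ t) (ht : t ≤ 1 / 2) :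
    IsElliptic (1 / 2 : ℝ) 2 ((1 : Matrix (Fin d) (Fin d) ℝ) + t • B) := by
  refine ⟨isSymm_one_add_smul hB.1 t, fun z => ?_⟩
  have hq : ∑ i, ∑ j, z i * ((1 : Matrix (Fin d) (Fin d) ℝ) + t • B) i j * z j =
      ∑ i, z i ^ 2 + t * ∑ i, ∑ j, z i * B i j * z j := by
    have h1 : ∀ i, ∑ j, z i * ((1 : Matrix (Fin d) (Fin d) ℝ) + t • B) i j * z j =
        z i ^ 2 + t * ∑ j, z i * B i j * z j := by
      intro i
      have : ∀ j, z i * ((1 : Matrix (Fin d) (Fin d) ℝ) + t • B) i j * z j =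
          z i * (1 : Matrix (Fin d) (Fin d) ℝ) i j * z j + t * (z i * B i j * z j) := by
        intro j; simp only [Matrix.add_apply, Matrix.smul_apply, smul_eq_mul]; ring
      rw [Finset.sum_congr rfl fun j _ => this j, Finset.sum_add_distrib, ← Finset.mul_sum]
      congr 1
      rw [Finset.sum_eq_single i (fun j _ hji => by rw [Matrix.one_apply_ne (Ne.symm hji)]; ring)
        (fun h => (h (Finset.mem_univ i)).elim), Matrix.one_apply_eq]
      ring
    rw [Finset.sum_congr rfl fun i _ => h1 i, Finset.sum_add_distrib, ← Finset.mul_sum]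
  rw [hq]
  have hBz := hB.2 z
  have habs := abs_le.1 hBz
  have hz : 0 ≤ ∑ i, z i ^ 2 := Finset.sum_nonneg fun i _ => sq_nonneg _
  constructor <;> nlinarith [habs.1, habs.2, hz, ht0, ht]

/-- **`0 ≤ Re 𝒞̂_{A,k}(κ)` for every mode** from clauses (o) (zero sums) and (v) (positive lower shell
bounds) of the decomposition, `A` elliptic, `1 ≤ k ≤ N+1`, `L ≥ 2`, `c > 0`.
[cite: Buchholz2016, Thm 2.4] -/
theorem re_fourierCoeff_nonneg_of_torusFRD
    {𝒞A : Matrix (Fin d) (Fin d) ℝ → ℕ → (Fin d → ZMod M) → ℝ} {c C : ℝ} {Cℓ : ℕ → ℝ}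
    {L N n ñ : ℕ} {A : Matrix (Fin d) (Fin d) ℝ}
    (ho : ∀ k, 1 ≤ k → k ≤ N + 1 → ∑ x : Fin d → ZMod M, 𝒞A A k x = 0 ∧ ∀ x, 𝒞A A k (-x) = 𝒞A A k x)
    (hv : ∀ k, 1 ≤ k → k ≤ N + 1 → ∀ j : ℕ, ∀ κ : Fin d → ZMod M, κ ≠ 0 → InShell L j κ →
        (j < k →
          c / (L : ℝ) ^ (2 * (d + ñ) + 1) * (L : ℝ) ^ (2 * j)
              / (L : ℝ) ^ ((k - j) * (d - 1 + n)) ≤ (fourierCoeff (𝒞A A k) κ).re ∧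
          ‖fourierCoeff (𝒞A A k) κ‖
            ≤ C * (L : ℝ) ^ (2 * (d + ñ) + 1) * (L : ℝ) ^ (2 * j)
                / (L : ℝ) ^ ((k - j) * (d - 1 + n))) ∧
        (k ≤ j →
          c / (L : ℝ) ^ (2 * (d + ñ) + 1) * (L : ℝ) ^ (2 * k)
              ≤ (fourierCoeff (𝒞A A k) κ).re ∧
          ‖fourierCoeff (𝒞A A k) κ‖ ≤ C * (L : ℝ) ^ (2 * k)) ∧
        ∀ B : Matrix (Fin d) (Fin d) ℝ, IsUnitSymm B → ∀ ℓ : ℕ, 1 ≤ ℓ →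
          (j < k →
            ‖iteratedDeriv ℓ (fun s : ℝ => fourierCoeff (𝒞A (A + s • B) k) κ) 0‖
              ≤ Cℓ ℓ * (L : ℝ) ^ (2 * (d + ñ) + 1) * (L : ℝ) ^ (2 * j)
                  / (L : ℝ) ^ ((k - j) * (d - 1 + ñ))) ∧
          (k ≤ j →
            ‖iteratedDeriv ℓ (fun s : ℝ => fourierCoeff (𝒞A (A + s • B) k) κ) 0‖
              ≤ Cℓ ℓ * (L : ℝ) ^ (2 * k)))
    (hc : 0 < c) (hL : 2 ≤ L) {k : ℕ} (hk1 : 1 ≤ k) (hkN : k ≤ N + 1) (κ : Fin d → ZMod M) :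
    0 ≤ (fourierCoeff (𝒞A A k) κ).re := by
  by_cases hκ : κ = 0
  · rw [hκ, re_fourierCoeff_zero_of_sum_eq_zero (ho k hk1 hkN).1]
  · obtain ⟨j, hj⟩ := exists_inShell hL hκ
    have hL0 : (0 : ℝ) < L := by exact_mod_cast (show 0 < L by omega)
    rcases lt_or_ge j k with hjk | hkj
    · exact le_trans (by positivity) (((hv k hk1 hkN j κ hκ hj).1 hjk).1)
    · exact le_trans (by positivity) (((hv k hk1 hkN j κ hκ hj).2.1 hkj).1)

/-- **[ABKM19] (7.75) for every mode**: for a package `𝒞A` with clauses (o), (iv), (v) of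
`TorusFRD d` at `ω₀ = ½`, `Ω₀ = 2` (verbatim, for every elliptic `A`), `B` unit symmetric,
`0 ≤ T ≤ ½`, `1 ≤ k ≤ N+1`, `L ≥ 2`, `ρ ≥ 0` and `shellRatioConst c (Cℓ 1) L d ñ · T ≤ log (1+ρ)`:
`Re 𝒞̂_{1+T•B,k}(κ) ≤ (1+ρ) · Re 𝒞̂_{1,k}(κ)` for every `κ`.
[cite: AdamsBuchholzKoteckyMuller2019, Lemma 7.7 (7.75)] -/
theorem re_fourierCoeff_one_add_smul_le
    {𝒞A : Matrix (Fin d) (Fin d) ℝ → ℕ → (Fin d → ZMod M) → ℝ} {c C : ℝ} {Cℓ : ℕ → ℝ}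
    {Cα : (Fin d → ℕ) → ℕ → ℝ} {L N n ñ : ℕ}
    (ho : ∀ A : Matrix (Fin d) (Fin d) ℝ, IsElliptic (1 / 2 : ℝ) 2 A →
      ∀ k, 1 ≤ k → k ≤ N + 1 → ∑ x : Fin d → ZMod M, 𝒞A A k x = 0 ∧ ∀ x, 𝒞A A k (-x) = 𝒞A A k x)
    (hiv : ∀ A : Matrix (Fin d) (Fin d) ℝ, IsElliptic (1 / 2 : ℝ) 2 A →
      ∀ k, 1 ≤ k → k ≤ N + 1 → ∀ B : Matrix (Fin d) (Fin d) ℝ, IsUnitSymm B →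
        (∃ ε : ℝ, 0 < ε ∧ ∀ x : Fin d → ZMod M,
          ContDiffOn ℝ ⊤ (fun s : ℝ => 𝒞A (A + s • B) k x) (Set.Ioo (-ε) ε)) ∧
        ∀ α : Fin d → ℕ, ∑ i, α i ≤ n → ∀ ℓ : ℕ, ∀ x : Fin d → ZMod M,
          abs (iteratedDeriv ℓ (fun s : ℝ => GradientFRD.iterDiff α (𝒞A (A + s • B) k) x) 0)
            ≤ Cα α ℓ / (L : ℝ) ^ ((k - 1) * (d - 2 + ∑ i, α i)))
    (hv : ∀ A : Matrix (Fin d) (Fin d) ℝ, IsElliptic (1 / 2 : ℝ) 2 A →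
      ∀ k, 1 ≤ k → k ≤ N + 1 → ∀ j : ℕ, ∀ κ : Fin d → ZMod M, κ ≠ 0 → InShell L j κ →
        (j < k →
          c / (L : ℝ) ^ (2 * (d + ñ) + 1) * (L : ℝ) ^ (2 * j)
              / (L : ℝ) ^ ((k - j) * (d - 1 + n)) ≤ (fourierCoeff (𝒞A A k) κ).re ∧
          ‖fourierCoeff (𝒞A A k) κ‖
            ≤ C * (L : ℝ) ^ (2 * (d + ñ) + 1) * (L : ℝ) ^ (2 * j)
                / (L : ℝ) ^ ((k - j) * (d - 1 + n))) ∧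
        (k ≤ j →
          c / (L : ℝ) ^ (2 * (d + ñ) + 1) * (L : ℝ) ^ (2 * k)
              ≤ (fourierCoeff (𝒞A A k) κ).re ∧
          ‖fourierCoeff (𝒞A A k) κ‖ ≤ C * (L : ℝ) ^ (2 * k)) ∧
        ∀ B : Matrix (Fin d) (Fin d) ℝ, IsUnitSymm B → ∀ ℓ : ℕ, 1 ≤ ℓ →
          (j < k →
            ‖iteratedDeriv ℓ (fun s : ℝ => fourierCoeff (𝒞A (A + s • B) k) κ) 0‖
              ≤ Cℓ ℓ * (L : ℝ) ^ (2 * (d + ñ) + 1) * (L : ℝ) ^ (2 * j)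
                  / (L : ℝ) ^ ((k - j) * (d - 1 + ñ))) ∧
          (k ≤ j →
            ‖iteratedDeriv ℓ (fun s : ℝ => fourierCoeff (𝒞A (A + s • B) k) κ) 0‖
              ≤ Cℓ ℓ * (L : ℝ) ^ (2 * k)))
    (hc : 0 < c) (hC1 : 0 ≤ Cℓ 1) (hL : 2 ≤ L) (hn : n ≤ ñ)
    {B : Matrix (Fin d) (Fin d) ℝ} (hB : IsUnitSymm B) {T : ℝ} (hT0 : 0 ≤ T) (hT : T ≤ 1 / 2)
    {k : ℕ} (hk1 : 1 ≤ k) (hkN : k ≤ N + 1) {ρ : ℝ} (hρ : 0 ≤ ρ)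
    (hKT : shellRatioConst c (Cℓ 1) (L : ℝ) d ñ * T ≤ Real.log (1 + ρ)) (κ : Fin d → ZMod M) :
    (fourierCoeff (𝒞A ((1 : Matrix (Fin d) (Fin d) ℝ) + T • B) k) κ).re ≤
      (1 + ρ) * (fourierCoeff (𝒞A 1 k) κ).re := by
  have hell : ∀ t ∈ Icc 0 T, IsElliptic (1 / 2 : ℝ) 2 ((1 : Matrix (Fin d) (Fin d) ℝ) + t • B) :=
    fun t ht => isElliptic_one_add_smul hB ht.1 (ht.2.trans hT)
  by_cases hκ : κ = 0
  · have h1 : (fourierCoeff (𝒞A ((1 : Matrix (Fin d) (Fin d) ℝ) + T • B) k) κ).re = 0 := by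
      rw [hκ]
      exact re_fourierCoeff_zero_of_sum_eq_zero ((ho _ (hell T ⟨hT0, le_rfl⟩) k hk1 hkN).1)
    have h2 : (fourierCoeff (𝒞A 1 k) κ).re = 0 := by
      rw [hκ]
      exact re_fourierCoeff_zero_of_sum_eq_zero ((ho _ GradientFRD.isElliptic_one k hk1 hkN).1)
    rw [h1, h2, mul_zero]
  · obtain ⟨j, hj⟩ := exists_inShell hL hκ
    have h := re_fourierCoeff_le_one_add_mul_of_torusFRD hiv hv hc hC1 (by omega) hn hB hT0 hell hk1 hkN
      hκ hj (by linarith) hKT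
    simpa using h

end Literature.MathematicalPhysics.StatisticalMechanics.GradientRG

end
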